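import Literature.Analysis.FluidPDE.CriticalRegularity
import Literature.Analysis.FluidPDE.TaoAveragedEuler
import HarnessLib

/-!
# Barrier: norm inflation in the largest critical space `Ḃ^{-1}_{∞,∞}` (Bourgain–Pavlović 2008)

Barrier catalogue entry for `NavierStokesRegularity` (D-0021). Vendors Theorem 1.1 of
J. Bourgain, N. Pavlović, *Ill-posedness of the Navier–Stokes equations in a critical space in
3D*, J. Funct. Anal. 255 (2008), 2233–2247 (arXiv:0807.0882) as a named fact over the accepted
vocabulary: Schwartz fields (`Literature.Analysis.FluidPDE.IsSchwartzField`), pointwise divergence-freeness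
(`Literature.Analysis.FluidPDE.VectorCalculus.IsDivFree`), classical solutions (`Literature.Analysis.FluidPDE.IsClassicalNSSolutionOn`), the tempered
distribution of a field (`Literature.Analysis.FluidPDE.IsDistributionOf`) and the homogeneous Besov norm
`Literature.eHomBesovNorm (-1) ∞ ∞` (`Ḃ^{-1}_{∞,∞}`, Littlewood–Paley definition, BCD Def. 2.15).
Bourgain–Pavlović themselves use the caloric norm `sup_{t>0} t^{1/2}‖e^{tΔ}f‖_{L^∞}` (their
§2.1); the Littlewood–Paley norm is taken UP TO EQUIVALENCE of norms (heat-kernel characterisation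
of negative-index Besov spaces, BCD Thm. 2.34), under which norm inflation is invariant
(`δ ↦ δ/C`).

## What is printed

* Thm. 1.1: for any `δ > 0` there exists a solution `(u, p)` to the Navier–Stokes equations
  (1.1)–(1.3) and `0 < t < δ` such that `u(0) ∈ 𝒮`, `‖u(0)‖_{Ḃ^{-1,∞}_∞} ≤ δ`, and
  `‖u(t)‖_{Ḃ^{-1,∞}_∞} > 1/δ` ("norm inflation"; the solution map is discontinuous at `0` in
  `Ḃ^{-1,∞}_∞`).
* §1: `Ḃ^{-1,∞}_∞` is the largest critical space (`Ḣ^{1/2} ↪ L³ ↪ Ḃ^{-1+3/p}_{p,∞} ↪ BMO⁻¹ ↪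
  Ḃ^{-1,∞}_∞`); Koch–Tataru's `BMO⁻¹` is the largest of these with small-data well-posedness;
  Montgomery-Smith's cheap-equation blow-up "suggests that the applications of a fixed point
  argument that are available up to now are not likely to produce an existence result for the
  Navier-Stokes equations themselves in the largest critical space, but it does not prove this
  for the actual Navier-Stokes equations"; the solution is written `u = e^{tΔ}u₀ - u₁ + y` with `y`
  controlled in Koch–Tataru's space `X_T` (§1 p. 4, §3); Germain (2008): the flow map is not `C²`
  in `Ḃ^{-1,q}_∞`, `q > 2`; §3.1: the data actually written down are finite trigonometric sums
  (the localisation to `𝒮` asserted in Thm. 1.1 is not carried out in print; a full proof with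
  Schwartz-class data on `ℝ³` — Fourier transforms compactly supported — is Deng–Yao 2013,
  arXiv:1302.7084, Thm. 1.3 with (2.1), Rmk. 2.1(i) and Lemma 3.6, whose lower bound passes through
  `‖·‖_{Ḃ^{-1,∞}_∞}`; the periodic versions are Yoneda 2010, Thm. 10 and Cheskidov–Dai 2014, Thm. 1;
  the textbook proof, Lemarié-Rieusset Thm. 9.7, uses lacunary cosine sums, for every `ν > 0`).
* Audit 2026-08-16 (refuter barrier-audit): the analytic content is CONFIRMED at page level; the
  technique class is NARROWED — see `criticalBesovNormInflationNarrow` below for the class the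
  printed results actually cover (continuity / uniform small-data control in the `Ḃ^{-1}_{∞,q}`
  DATA topology) and for what is NOT blocked (Koch–Tataru-type fixed points in `BMO⁻¹` and
  smaller spaces; regularity criteria; non-perturbative uses of `Ḃ^{-1}_{∞,∞}`-smallness — norm
  inflation coexists with global regularity: Wang 2015 for `q ≤ 2`, Cheskidov–Dai 2014 for
  hyperdissipation `α ≥ 5/4`).

## Rendering

The printed statement is existential in the solution. We take `ν = 1` (the paper's (1.1) carries
a fixed `ν > 0`; `ν = 1` is the Koch–Tataru normalisation used in its §2, and other viscosities
follow by `u ↦ ν⁻¹u(ν⁻¹t, ·)`, which multiplies `Ḃ^{-1}_{∞,∞}` norms by `ν⁻¹`), and we ask the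
witness `u` to be a *bounded classical* solution on `[0,t] × ℝ³` from the Schwartz datum,
which the Bourgain–Pavlović solution (`e^{tΔ}u₀ - u₁ + y`, `y ∈ X_T`, §3) is by the standard local
theory (this is STRONGER than the printed "a solution `(u,p)`" and rests on that theory, not on
the paper). Bounded classical solutions from a given datum are still not unique — Galilean drifts
`u(x - a(t), t) + a'(t)`, `p - a''(t)·x` with `a(0) = a'(0) = 0` are bounded classical solutions
from the same datum (cf. the design notes of `CriticalRegularity.lean`) — but the rendering stays
honest: `Ḃ^{-1}_{∞,∞}` is translation invariant and the Littlewood–Paley blocks `Δ̇_j` kill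
constants, so drifts do not change the norm at time `t`, while the bound `‖u‖ ≤ M` excludes the
linearly growing strain solutions `A(t)x` that could inflate the norm without the paper's
mechanism. Divergence-freeness of the datum is part of "solution". The Besov norms are read off
tempered-distribution representatives `U₀`, `U_t` of the slices (`IsDistributionOf`).

## References

* J. Bourgain, N. Pavlović, J. Funct. Anal. 255 (2008), 2233–2247. [`BourgainPavlovic2008`]
* H. Koch, D. Tataru, Adv. Math. 157 (2001). [`KochTataruAdvMath2001`]
* P. Germain, J. Funct. Anal. 255 (2008). [`Germain2008`]; T. Yoneda, J. Funct. Anal. 258 (2010).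
  [`Yoneda2010`]; B. Wang, Adv. Math. 268 (2015). [`Wang2015`]
* S. Montgomery-Smith, Proc. AMS 129 (2001). [`MontgomerySmith2001`]
* C. Deng, X. Yao, *Ill-posedness of the incompressible Navier–Stokes equations in
  `Ḟ^{-1,q}_∞(ℝ³)`*, arXiv:1302.7084 (2013). [`DengYao2013`]
* A. Cheskidov, M. Dai, *Norm inflation for generalized Navier–Stokes equations*, Indiana Univ.
  Math. J. 63 (2014) 869–884 = arXiv:1212.3801. [`CheskidovDai2014`]
* M. P. Coiculescu, S. Palasek, Invent. Math. 244 (2025) = arXiv:2503.14699, §1.1.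
  [`CoiculescuPalasek2025`]
* P. G. Lemarié-Rieusset, *The Navier–Stokes Problem in the 21st Century*, CRC Press (2016; the held
  copy is the 2nd edition, whose numbering is used: §9.5 Thm. 9.7, §9.6 Def. 9.1–9.2, Thm. 9.8).
  [`LemarieRieusset2016`]
* A. Cheskidov, R. Shvydkoy, ARMA 195 (2010). [`CheskidovShvydkoy2010`]
* H. Bahouri, J.-Y. Chemin, R. Danchin, *Fourier Analysis and Nonlinear PDE*, GL 343 (2011),
  Def. 2.15, Thm. 2.34. [`BahouriCheminDanchinGL343`]
-/

noncomputable section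

open MeasureTheory Set
open scoped ENNReal SchwartzMap

namespace Literature.Barriers.NavierStokesRegularity

/-- Local notation for physical space `ℝ³ = EuclideanSpace ℝ (Fin 3)`. -/
local notation "ℝ³" => EuclideanSpace ℝ (Fin 3)
/-- Local notation for the complexified value space `ℂ³`. -/
local notation "ℂ³" => EuclideanSpace ℂ (Fin 3)

/-- **Barrier (Bourgain–Pavlović 2008): norm inflation for Navier–Stokes in `Ḃ^{-1}_{∞,∞}`.**
For every `δ > 0` there are a Schwartz, divergence-free datum `u₀ : ℝ³ → ℝ³` with
`‖u₀‖_{Ḃ^{-1}_{∞,∞}} ≤ δ`, a time `0 < t < δ`, and a bounded classical solution `(u, p)` of the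
unforced Navier–Stokes equations (`ν = 1`) on `ℝ³ × [0, t]` with `u(0) = u₀`, such that
`‖u(t)‖_{Ḃ^{-1}_{∞,∞}} > 1/δ`. Besov norms are those of tempered-distribution representatives of
the slices (`Literature.Analysis.FluidPDE.IsDistributionOf`, `Literature.eHomBesovNorm (-1) ∞ ∞`). See the module docstring
for the rendering choices (`ν = 1`, bounded classical witness).
[cite: BourgainPavlovic2008, Thm. 1.1]

BARRIER (structured block, D-0021):
technique_class: perturbative-mild-solution fixed-point-iteration critical-space-wellposedness semigroup-method largest-critical-space mild-solutions critical-spaces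
blocks: the strengthening of NavierStokesRegularity to "well-posedness with continuous dependence on the data in the largest critical space `Ḃ^{-1}_{∞,∞}`", i.e. extending the in-tree small-data theory `Literature.Analysis.FluidPDE.koch_tataru` (ns.S15, `BMO⁻¹`) [cite: KochTataruAdvMath2001, Thm. 2] to the endpoint of the chain `Ḣ^{1/2} ↪ L³ ↪ Ḃ^{-1+3/p}_{p,∞} ↪ BMO⁻¹ ↪ Ḃ^{-1}_{∞,∞}` — "a long standing open problem", answered negatively: the data-to-solution map is discontinuous at `0` in `Ḃ^{-1,∞}_∞` [cite: BourgainPavlovic2008, abstract, §1 and Thm. 1.1]; the fixed-point construction of mild solutions is moreover ruled out in `Ḃ^{-1,q}_∞`, `q > 2` (map not `C²`) [cite: Germain2008, as reported by Bourgain–Pavlović 2008 §1 and Coiculescu–Palasek 2025 §1.1] and norm inflation persists in `Ḃ^{-1}_{∞,q}`, all `q`, even `q ≤ 2` [cite: Wang2015, as reported by Coiculescu–Palasek 2025 §1.1] [cite: Yoneda2010, as reported ibid.].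
because: for Schwartz data built from high-frequency plane-wave pairs whose Euler interaction has a large low-frequency component, the second Picard iterate `u₁ = ∫₀ᵗ e^{(t-τ)Δ} P(e^{τΔ}u₀·∇)e^{τΔ}u₀ dτ` splits as `u_{1,0} + u_{1,1}` with `u_{1,0}` of `Ḃ^{-1}_{∞,∞}`-size `> 1/δ` at some time `t < δ` while `‖u₀‖ ≤ δ`, and the remainder `y` in `u = e^{tΔ}u₀ - u₁ + y` stays controlled in Koch–Tataru's `X_T` [cite: BourgainPavlovic2008, §1 (main idea) and §3].
evasions_known: work inside `BMO⁻¹` or smaller critical spaces, where small-data global well-posedness holds [cite: KochTataruAdvMath2001, Thm. 2]; regularity CRITERIA (as opposed to well-posedness) survive at the endpoint: a Leray–Hopf solution with small left jumps in `B^{-1}_{∞,∞}` is regular — the in-tree `Literature.Analysis.FluidPDE.cheskidov_shvydkoy` (ns.S31) [cite: CheskidovShvydkoy2010, Thm. 3.1]; global existence for large data in `Ḃ^{-1,∞}_∞` under a nonlinear smallness condition (Chemin–Gallagher) is reported as complementary [cite: BourgainPavlovic2008, §1].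
scope_caveats: (a) BP define `‖f‖_{Ḃ^{-1,∞}_∞} = sup_{t>0} t^{1/2}‖e^{tΔ}f‖_∞` (caloric norm) while the fact uses the Littlewood–Paley `Literature.eHomBesovNorm (-1) ∞ ∞` — equivalent norms [cite: BahouriCheminDanchinGL343, Thm. 2.34], and inflation is invariant under equivalence via `δ' = δ/C` [cite: BourgainPavlovic2008, §2.1]; (b) `ν = 1` only (Koch–Tataru normalisation) [cite: BourgainPavlovic2008, §2.2] (the textbook version of the theorem is stated and proved for every `ν > 0` [cite: LemarieRieusset2016, §9.5 Thm. 9.7]); (c) the witness is required to be a BOUNDED CLASSICAL solution, stronger than the printed "a solution `(u,p)`", resting on standard local theory rather than on the paper [cite: BourgainPavlovic2008, Thm. 1.1]; (d) the data actually constructed are finite trigonometric sums (its (3.1)–(3.3)), not Schwartz — Thm. 1.1 asserts `u(0) ∈ 𝒮` but the printed proof carries out no localisation [cite: BourgainPavlovic2008, §3.1]; the other printed constructions are periodic `BUC` data [cite: Yoneda2010, Thm. 10 and Rmk. 9], smooth `2π`-periodic data [cite: CheskidovDai2014, Thm. 1] and, in the textbook proof, lacunary cosine sums (its (9.10), data in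 `ℰ₂`) [cite: LemarieRieusset2016, §9.5 Thm. 9.7 and (9.10)], while a complete proof with Schwartz-class data on `ℝ³` (Fourier transforms supported in finitely many balls, real, divergence-free, `L²`) is the PREPRINT Deng–Yao 2013: inflation in `Ḟ^{-1,q}_∞(ℝ³)`, `2 < q < ∞`, whose data are small in `Ḃ^{-1,∞}_∞ ⊃ Ḟ^{-1,q}_∞` and whose lower bound is proved through `‖u_{200}(T)‖_{Ḃ^{-1,∞}_∞} ≳ ‖u_{200}(T)‖_∞ ≳ Q²` with all remainders small in `Ḟ^{-1,q}_∞ ↪ Ḃ^{-1,∞}_∞`, so that it yields the Schwartz clause of this fact [cite: DengYao2013, Thm. 1.3, (2.1), Rmk. 2.1(i), Lemma 3.6]; Wang's Schwartz-data construction on `ℝⁿ` inflates only by `(log N)^{1/(2q)}`, vacuous at `q = ∞` [cite: Wang2015, Thm. 1.2]; (e) an ILL-POSEDNESS statement about continuity of the data-to-solution map at `0` in one endpoint norm — no blow-up, no non-uniqueness, nothing about `BMO⁻¹` or smaller spaces, and not the regularity statement NavierStokesRegularity itself [cite: BourgainPavlovic2008, §1]; norm inflation is moreover "not monotone" in the space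 (it also occurs inside `BMO⁻¹` for globally regular small solutions) [cite: CoiculescuPalasek2025, §1.1]; (f) APPLICABILITY (audit 2026-08-16): the family tokens `perturbative-mild-solution fixed-point-iteration semigroup-method mild-solutions critical-spaces` of the technique class OVER-COVER what is printed — the fact constrains only schemes whose output would control `u(t)` in `Ḃ^{-1}_{∞,∞}` uniformly (continuously, or just boundedly on a uniform time interval) in terms of the `Ḃ^{-1}_{∞,q}` / `Ḟ^{-1}_{∞,q}` size of the datum; a card or route whose data topology is `BMO⁻¹` or smaller (Koch–Tataru `Literature.Analysis.FluidPDE.koch_tataru` IS a perturbative mild-solution fixed point [cite: KochTataruAdvMath2001, Thm. 2]), or which uses `Ḃ^{-1}_{∞,∞}` only in a regularity CRITERION (`Literature.Analysis.FluidPDE.cheskidov_shvydkoy`), or which adds structure to the data (`Ḃ^{-1}_{∞,q} ∩ Ḃ^0_{3,∞}`, `q < ∞`, Bae–Biswas–Tadmor, as reported in [cite: Wang2015, §1]; nonlinear smallness, Chemin–Gallagher, as reported in [cite: BourgainPavlovic2008, §1]) addresses this barrier by saying so; norm inflation is orthogonal to regularity — it coexists with global regularity and `BMO⁻¹`-smallness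 for `q ≤ 2` [cite: Wang2015, Thm. 1.2] [cite: CoiculescuPalasek2025, §1.1] and with Lions' global regularity for hyperdissipation `α ≥ 5/4` [cite: CheskidovDai2014, §1 and Thm. 1] — so the bare implication "Schwartz data small in `Ḃ^{-1}_{∞,∞}` ⇒ global regularity" (weaker than NavierStokesRegularity) is NOT refuted, only its perturbative proofs are; the sharp blocked statement is `criticalBesovNormInflationNarrow`.
status: established -/
def CriticalBesovNormInflation : Prop :=
  ∀ δ : ℝ, 0 < δ →
    ∃ (u₀ : ℝ³ → ℝ³) (U₀ : 𝓢'(ℝ³, ℂ³)),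
      Literature.Analysis.FluidPDE.IsSchwartzField u₀ ∧ Literature.Analysis.FluidPDE.VectorCalculus.IsDivFree u₀ ∧ Literature.Analysis.FluidPDE.IsDistributionOf u₀ U₀ ∧
      Literature.Analysis.FunctionSpaces.eHomBesovNorm (-1) ∞ ∞ U₀ ≤ ENNReal.ofReal δ ∧
      ∃ t : ℝ, 0 < t ∧ t < δ ∧
        ∃ (u : ℝ → ℝ³ → ℝ³) (p : ℝ → ℝ³ → ℝ) (Ut : 𝓢'(ℝ³, ℂ³)),
          Literature.Analysis.FluidPDE.IsClassicalNSSolutionOn (Icc 0 t) 1 0 u p ∧ u 0 = u₀ ∧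
          (∃ M : ℝ, ∀ s ∈ Icc 0 t, ∀ x, ‖u s x‖ ≤ M) ∧
          Literature.Analysis.FluidPDE.IsDistributionOf (u t) Ut ∧ ENNReal.ofReal (1 / δ) < Literature.Analysis.FunctionSpaces.eHomBesovNorm (-1) ∞ ∞ Ut

/-- Immediate reformulation (unboundedness of the solution map near `0`; Bourgain–Pavlović 2008,
abstract: "the solution map itself is discontinuous in `Ḃ^{-1,∞}_∞` at the origin"): there is NO
`δ > 0` such that every bounded classical solution from a Schwartz divergence-free datum of
`Ḃ^{-1}_{∞,∞}`-norm `≤ δ` keeps `Ḃ^{-1}_{∞,∞}`-norm `≤ 1/δ` at all times `t < δ`. Proved from the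
barrier fact. [cite: BourgainPavlovic2008, Thm. 1.1] -/
theorem CriticalBesovNormInflation.not_bounded_near_zero (h : CriticalBesovNormInflation) :
    ¬ ∃ δ : ℝ, 0 < δ ∧ ∀ (u₀ : ℝ³ → ℝ³) (U₀ : 𝓢'(ℝ³, ℂ³)),
      Literature.Analysis.FluidPDE.IsSchwartzField u₀ → Literature.Analysis.FluidPDE.VectorCalculus.IsDivFree u₀ → Literature.Analysis.FluidPDE.IsDistributionOf u₀ U₀ →
      Literature.Analysis.FunctionSpaces.eHomBesovNorm (-1) ∞ ∞ U₀ ≤ ENNReal.ofReal δ →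
      ∀ t : ℝ, 0 < t → t < δ →
        ∀ (u : ℝ → ℝ³ → ℝ³) (p : ℝ → ℝ³ → ℝ) (Ut : 𝓢'(ℝ³, ℂ³)),
          Literature.Analysis.FluidPDE.IsClassicalNSSolutionOn (Icc 0 t) 1 0 u p → u 0 = u₀ →
          (∃ M : ℝ, ∀ s ∈ Icc 0 t, ∀ x, ‖u s x‖ ≤ M) →
          Literature.Analysis.FluidPDE.IsDistributionOf (u t) Ut → Literature.Analysis.FunctionSpaces.eHomBesovNorm (-1) ∞ ∞ Ut ≤ ENNReal.ofReal (1 / δ) := by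
  rintro ⟨δ, hδ, hall⟩
  obtain ⟨u₀, U₀, hS, hdiv, hU₀, hsmall, t, ht, htδ, u, p, Ut, hsol, hinit, hbdd, hUt, hbig⟩ :=
    h δ hδ
  exact absurd (hall u₀ U₀ hS hdiv hU₀ hsmall t ht htδ u p Ut hsol hinit hbdd hUt) (not_le.2 hbig)

/-- **Barrier, narrowed technique class (audit 2026-08-16): no uniform small-data control of the
`Ḃ^{-1}_{∞,∞}` norm near `t = 0`.** There are NO `t₀ > 0`, `ε > 0` and `K` such that every bounded
classical solution `(u, p)` of the unforced Navier–Stokes equations (`ν = 1`) on `ℝ³ × [0, t]`,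
`t < t₀`, from a Schwartz divergence-free datum `u₀` with `‖u₀‖_{Ḃ^{-1}_{∞,∞}} ≤ ε` satisfies
`‖u(t)‖_{Ḃ^{-1}_{∞,∞}} ≤ K`. This is the statement that Bourgain–Pavlović norm inflation actually
refutes (take `δ < min(t₀, ε, 1/K)` in `CriticalBesovNormInflation`, the hypothesis `h` of this
theorem — zero fact debt: the displayed statement is PROVED from the vendored fact): it kills
CONTINUITY at `0` of the data-to-solution map for the `Ḃ^{-1}_{∞,∞}` data topology and, more
generally, every small-data A PRIORI BOUND of the
`Ḃ^{-1}_{∞,∞}` norm on a uniform time interval in terms of the `Ḃ^{-1}_{∞,∞}` norm of the datum alone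
— and nothing else. Same vocabulary and rendering as `CriticalBesovNormInflation`.
[cite: BourgainPavlovic2008, Thm. 1.1]

BARRIER (structured block, D-0021):
technique_class: largest-critical-space besov-endpoint-flow-map-continuity besov-endpoint-apriori-bound uniform-small-data-control-in-B-infty-infty critical-space-wellposedness
blocks: exactly the statements of the displayed shape and what implies them: (1) continuity at `0` of `u₀ ↦ u(t)` from the `Ḃ^{-1}_{∞,q}(ℝ³)` (`1 ≤ q ≤ ∞`) or `Ḟ^{-1}_{∞,q}(ℝ³)` (`q > 2`) topology on smooth divergence-free data into `Ḃ^{-1}_{∞,∞}` at small positive times [cite: BourgainPavlovic2008, Thm. 1.1] [cite: Yoneda2010, Thm. 10] [cite: DengYao2013, Thm. 1.3] [cite: Wang2015, Thm. 1.2] (textbook form: the equations are ill-posed in `B^{-1}_{∞,q}` for every `1 ≤ q ≤ ∞` in the Bejenaru–Tao sense of its Def. 9.2 [cite: LemarieRieusset2016, §9.6 Thm. 9.8]) — hence every Picard / fixed-point / continuity-method scheme set in a path space embedding into `L^∞(0, t₀; Ḃ^{-1}_{∞,∞})` whose data norm is dominated by `‖·‖_{Ḃ^{-1}_{∞,q}}`,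 i.e. "well-posedness in the largest critical space" extending `Literature.Analysis.FluidPDE.koch_tataru` past `BMO⁻¹` [cite: KochTataruAdvMath2001, Thm. 2]; (2) any a priori estimate `sup_{t<t₀} ‖u(t)‖_{Ḃ^{-1}_{∞,∞}} ≤ F(‖u₀‖_{Ḃ^{-1}_{∞,∞}})` with `F` bounded near `0` for smooth solutions (the displayed conclusion). NOT blocked, although the family tokens `perturbative-mild-solution fixed-point-iteration semigroup-method mild-solutions critical-spaces` of `CriticalBesovNormInflation` match them: (a) the same schemes with data topology `BMO⁻¹` or smaller — Kato `L³`, Cannone–Planchon `Ḃ^{-1+3/p}_{p,q}`, Koch–Tataru — which are theorems [cite: KochTataruAdvMath2001, Thm. 2]; (b) structured data large or rough in `Ḃ^{-1}_{∞,∞}`: `Ḃ^{-1}_{∞,q} ∩ Ḃ^0_{3,∞}`, `q < ∞` (Bae–Biswas–Tadmor 2012, as reported in [cite: Wang2015, §1]), nonlinear smallness (Chemin–Gallagher, as reported in [cite: BourgainPavlovic2008, §1]); (c) regularity CRITERIA at the `Ḃ^{-1}_{∞,∞}` level, e.g. `Literature.Analysis.FluidPDE.cheskidov_shvydkoy` [cite: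 CheskidovShvydkoy2010, Thm. 3.1]; (d) non-perturbative routes to "Schwartz data small in `Ḃ^{-1}_{∞,∞}` ⇒ global regularity": norm inflation is orthogonal to regularity — it coexists with global regularity and `BMO⁻¹`-smallness in `Ḃ^{-1}_{∞,q}`, `q ≤ 2` [cite: Wang2015, Thm. 1.2] [cite: CoiculescuPalasek2025, §1.1] and with Lions' global regularity for hyperdissipation `α ≥ 5/4` ("backwards energy cascade, harmless as far as the regularity of a solution is concerned") [cite: CheskidovDai2014, §1 and Thm. 1]; that implication is open (and weaker than NavierStokesRegularity), only its perturbative proofs are dead.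
because: Bourgain–Pavlović's datum of `Ḃ^{-1}_{∞,∞}`-size `Q/√r ≤ δ` produces, through the low-frequency part `u_{1,0}` of the second Picard iterate (pairs of plane waves `k_s`, `k_s' = k_s - η` depositing `∼ Q²/r` each into the mode `sin(η·x)`), a solution of `Ḃ^{-1}_{∞,∞}`-size `> Q²/2 > 1/δ` at a time `T < Q^{-8} < δ`, the remainder being controlled in Koch–Tataru's `X_T` [cite: BourgainPavlovic2008, §3]; given `t₀, ε, K`, the choice `δ = min(t₀, ε, 1/(|K|+1))` contradicts the displayed bound (the proof below).
evasions_known: (a)–(d) of `blocks`; in particular work in `BMO⁻¹` or smaller [cite: KochTataruAdvMath2001, Thm. 2], or intersect the endpoint space with a second critical space (Bae–Biswas–Tadmor, as reported in [cite: Wang2015, §1]), or replace norm-smallness by a structural / nonlinear smallness condition (Chemin–Gallagher, as reported in [cite: BourgainPavlovic2008, §1]); for hypodissipation `1/2 < α < 1` the largest critical space `Ḃ^{1-2α}_{∞,∞}` IS a well-posedness space (Yu–Zhai 2012, as reported in [cite: CheskidovDai2014, §1]), so the obstruction is tied to the exact balance `α = 1` (and persists for `α > 1`).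
scope_caveats: (a) a COROLLARY of the vendored fact `CriticalBesovNormInflation`, carrying its rendering choices (`ν = 1`, Littlewood–Paley norm up to equivalence, bounded classical witnesses) [cite: BourgainPavlovic2008, Thm. 1.1]; (b) the narrowing concerns the TECHNIQUE CLASS, not the analysis: the displayed statement is implied by, and for planning purposes equivalent to, norm inflation; (c) Schwartz data on `ℝ³`: complete printed proof only in the preprint [cite: DengYao2013, Thm. 1.3 and Lemma 3.6], asserted in [cite: BourgainPavlovic2008, Thm. 1.1] (proof printed for trigonometric sums), periodic versions [cite: Yoneda2010, Thm. 10] [cite: CheskidovDai2014, Thm. 1]; (d) silent on data confined to sets where `‖·‖_{Ḃ^{-1}_{∞,∞}}` is comparable to `‖·‖_{BMO⁻¹}` (single-scale or finitely-banded spectra), where Koch–Tataru gives uniform control; (e) silent on weaker TARGET topologies (continuity of `u₀ ↦ u(t)` into `Ḃ^{-1-s}_{∞,∞}`, `s > 0`, or into `𝓢'`) for the classical equations — the hyperdissipative analogue inflates in every `Ḃ^{-s}_{∞,∞}` [cite: CheskidovDai2014, Thm. 1], the classical statement printed is for `s = 1` only [cite: BourgainPavlovic2008, Thm. 1.1].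
status: established (a theorem conditional on the vendored fact `CriticalBesovNormInflation`, i.e. on [cite: BourgainPavlovic2008, Thm. 1.1]) -/
theorem criticalBesovNormInflationNarrow (h : CriticalBesovNormInflation) :
    ¬ ∃ (t₀ ε K : ℝ), 0 < t₀ ∧ 0 < ε ∧
        ∀ (u₀ : ℝ³ → ℝ³) (U₀ : 𝓢'(ℝ³, ℂ³)),
          Literature.Analysis.FluidPDE.IsSchwartzField u₀ → Literature.Analysis.FluidPDE.VectorCalculus.IsDivFree u₀ →
          Literature.Analysis.FluidPDE.IsDistributionOf u₀ U₀ →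
          Literature.Analysis.FunctionSpaces.eHomBesovNorm (-1) ∞ ∞ U₀ ≤ ENNReal.ofReal ε →
          ∀ t : ℝ, 0 < t → t < t₀ →
            ∀ (u : ℝ → ℝ³ → ℝ³) (p : ℝ → ℝ³ → ℝ) (Ut : 𝓢'(ℝ³, ℂ³)),
              Literature.Analysis.FluidPDE.IsClassicalNSSolutionOn (Icc 0 t) 1 0 u p → u 0 = u₀ →
              (∃ M : ℝ, ∀ s ∈ Icc 0 t, ∀ x, ‖u s x‖ ≤ M) →
              Literature.Analysis.FluidPDE.IsDistributionOf (u t) Ut →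
              Literature.Analysis.FunctionSpaces.eHomBesovNorm (-1) ∞ ∞ Ut ≤ ENNReal.ofReal K := by
  rintro ⟨t₀, ε, K, ht₀, hε, hall⟩
  have hK1 : 0 < |K| + 1 := by positivity
  set δ : ℝ := min (min t₀ ε) (1 / (|K| + 1)) with hδ_def
  have hδpos : 0 < δ := lt_min (lt_min ht₀ hε) (by positivity)
  have hδt : δ ≤ t₀ := (min_le_left _ _).trans (min_le_left _ _)
  have hδε : δ ≤ ε := (min_le_left _ _).trans (min_le_right _ _)
  have hδK' : δ ≤ 1 / (|K| + 1) := min_le_right _ _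
  have hmul : δ * (|K| + 1) ≤ 1 := by
    calc δ * (|K| + 1) ≤ 1 / (|K| + 1) * (|K| + 1) := by gcongr
      _ = 1 := by field_simp
  have hδK : K < 1 / δ := by
    rw [lt_div_iff₀ hδpos]
    nlinarith [le_abs_self K, mul_le_mul_of_nonneg_right (le_abs_self K) hδpos.le]
  obtain ⟨u₀, U₀, hS, hdiv, hU₀, hsmall, t, ht, htδ, u, p, Ut, hsol, hinit, hbdd, hUt, hbig⟩ :=
    h δ hδpos
  have hbound := hall u₀ U₀ hS hdiv hU₀ (hsmall.trans (ENNReal.ofReal_le_ofReal hδε)) t ht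
    (htδ.trans_le hδt) u p Ut hsol hinit hbdd hUt
  exact absurd (ENNReal.ofReal_le_ofReal hδK.le) (not_le.2 (hbig.trans_le hbound))

end Literature.Barriers.NavierStokesRegularity
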